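import Mathlib
import HarnessLib
import HarnessLib.Audit
import Summits.Parity.Statement
import Literature.NumberTheory.EllipticCurves.Selmer
import Summits.Parity.BatemanHorn.Theorems.IsogenyRedeiTypeIMainTerm
import Summits.Parity.BatemanHorn.Theorems.IsogenyRedeiLambdaToCount
import HarnessLib.Audit.Status.Attr

/-!
Route: SelmerPencil

DORMANT since 2026-08-24T04:10:10Z (reconciler: no traction for 6.5 d (last activity item-evidence-added at 2026-08-17T14:59:41Z); parked, not closed — `ledger route dormant route-Parity-SelmerPencil --off` to reactivate) — unstaffed, not closed; items shared with open routes are served there. `ledger route dormant <id> --off` reactivates.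

# Route SelmerPencil — Bateman–Horn parity input = 2^∞-Selmer parity of the universal pencil
y²+xy=x³−36F(t)x−F(t), where w = −(−1)^ω(F(t)) exactly

Conforming successor of route-Parity-SelmerParityReverse (retired not-a-thesis 2026-08-15: it
reached only Conjecture E); realises card
Parity/BatemanHorn/selmer-parity-reverse for EVERY Bateman–Horn system f = (f₁,…,f_k), F := ∏ f_i,
through ONE universal pencil: for N ≥ 1 let
E_N : y² + xy = x³ − 36N·x − N (c₄ = 1728N+1, c₆ = −(1728N+1), Δ = N(1728N+1)², j = 1728 + 1/N). E_N
is SPLIT multiplicative at every p ∣ N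
(v_p(c₄) = 0, tangent cone y(y+x); p = 2, 3 included), additive potentially good at p ∣ 1728N+1 (p ≥
5, v_p(Δ) = 2v_p(1728N+1)) and good elsewhere
(the Mathlib-only support PencilReduction records this), so by Rohrlich's table and (−1 | 1728N+1) =
+1 the root number is the closed form
w(E_N) = −(−1)^{ω(N)}·ε(N), ε(N) := ∏_{v_p(1728N+1) ≡ 2,4 (6)} (−3|p); no pliable factor, no tables
at 2 or 3. It suffices to show
X = PencilSelmerParity ∧ SelmerParityLevel: (i) the 2-parity theorem for the curves E_N in CLOSED
FORM, (−1)^{corank Sel_2∞(E_N/ℚ)} = −(−1)^{ω(N)}·ε(N)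
(Dokchitser–Dokchitser Thm 1.4 + the Deligne–Rohrlich product formula + Rohrlich's local table on
this model: a theorem in print, unproved in Lean,
typed over WeierstrassCurve.selmerCorank and Mathlib only, so that no root-number / L-function
vocabulary sits in the route's cone — cone repair
2026-08-15, rev 1: it replaces rev 0's pair TwoParityPencil ∧ PencilRootNumber), and (ii) for every
BH system with k ≥ 1, the normalised 2^∞-Selmer
parity ε(F(t))·ε′(F(t))·(−1)^{corank Sel_2∞(E_{F(t)})} (ε′(N) := ∏_{p∣N} (−1)^{v_p(N)+1}) has level
of distribution x^{1−η} (every η > 0) along the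
multiplicative fibres t ≡ ρ (m), m ∣ F(ρ). Then λ(F(t)) has the same level along root classes
(LiouvilleRootClassLevel; the rewriting is the support
ParityToLiouville), which is exactly the parity/cofactor input of the Möbius tail of route
PolynomialMobius; the window and Type-I bookkeeping
(TailGivenParity, TypeIMainTerm, LambdaToCount, TailToBatemanHorn) give BatemanHorn =
Literature.NumberTheory.Sieve.BatemanHornConjecture itself.
Lean: `(∀ N : ℕ, 1 ≤ N → (-1 : ℤ) ^ (WeierstrassCurve.selmerCorank (⟨1, 0, 0, -36 * (N : ℚ), -(N :
ℚ)⟩ : WeierstrassCurve ℚ) 2) = -((-1 : ℤ) ^ ArithmeticFunction.cardDistinctFactors N * ∏ p ∈ (1728 *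
N + 1).primeFactors, (if padicValNat p (1728 * N + 1) % 6 = 2 ∨ padicValNat p (1728 * N + 1) % 6 = 4
then jacobiSym (-3) p else 1))) ∧ (∀ (k : ℕ) (f : Fin k → Polynomial ℤ), 0 < k →
Literature.NumberTheory.Sieve.IsBatemanHornSystem f → ∀ η : ℝ, 0 < η → η < 1 → ∀ A : ℝ, 0 < A → ∃ x₀
: ℕ, ∀ x : ℕ, x₀ ≤ x → ∀ y : ℕ → ℕ → ℕ, (∀ m ρ, y m ρ ≤ x) → ∑ m ∈ Finset.Icc 1 ⌊(x : ℝ) ^ (1 -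
η)⌋₊, ∑ ρ ∈ (Finset.range m).filter (fun ρ : ℕ => (m : ℤ) ∣ (∏ i, f i).eval (ρ : ℤ)), |∑ t ∈
(Finset.Icc 1 (y m ρ)).filter (fun t : ℕ => t ≡ ρ [MOD m] ∧ 0 < (∏ i, f i).eval (t : ℤ)), (((∏ p ∈
(1728 * ((∏ i, f i).eval (t : ℤ)).toNat + 1).primeFactors, (if padicValNat p (1728 * ((∏ i, f
i).eval (t : ℤ)).toNat + 1) % 6 = 2 ∨ padicValNat p (1728 * ((∏ i, f i).eval (t : ℤ)).toNat + 1) % 6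
= 4 then jacobiSym (-3) p else 1)) * (∏ p ∈ (((∏ i, f i).eval (t : ℤ)).toNat).primeFactors, (-1 : ℤ)
^ (padicValNat p (((∏ i, f i).eval (t : ℤ)).toNat) + 1)) * (-1 : ℤ) ^ (WeierstrassCurve.selmerCorank
(⟨1, 0, 0, -36 * ((((∏ i, f i).eval (t : ℤ)).toNat : ℕ) : ℚ), -((((∏ i, f i).eval (t : ℤ)).toNat :
ℕ) : ℚ)⟩ : WeierstrassCurve ℚ) 2) : ℤ) : ℝ)| ≤ (x : ℝ) / Real.log x ^ A)`

## Assembly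
Deciding theorem `closes` (hypotheses = all eleven items, conclusion `_root_.BatemanHorn`), pure
logic, checked sorry-free in the planner's Sketch.lean
(`g₂ (hT (g₁ hP hS)) hM hL`): ParityToLiouville (g₁) turns PencilSelmerParity ∧ SelmerParityLevel
into LiouvilleRootClassLevel, TailGivenParity turns
that into the Möbius tail for every system, TailToBatemanHorn (g₂, PolynomialMobius bookkeeping)
with TypeIMainTerm and LambdaToCount yields
Literature.NumberTheory.Sieve.BatemanHornConjecture. The Assembly item (restated in rev 1 over the
new decls: PencilSelmerParity → SelmerParityLevel → TailGivenParity →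
TypeIMainTerm → LambdaToCount → BatemanHorn) is the provable-now conjunction of the two glue
supports; `closes` is the deciding theorem (D-0027). No Literature fact enters as a hidden
hypothesis: the 2-parity/product-formula input is the item
PencilSelmerParity. Imports: Literature.NumberTheory.EllipticCurves.Selmer only (rev 0 imported
…EllipticCurves.BSDSelmer, whose import cone carried
20 unproved named facts none of which any item uses; the dependency cone of the eleven items holds
no unproved Literature fact — #h21_route_deps probe,
49 project constants, only predicates and data definitions below the target).

Rationale: WHY THIS LINE. Helfgott2003RootNumbers (Prop. 5.4, Lemma 5.2–5.3, Thm 7.1) writes W(𝓔(t)) =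
g·h·λ(M_𝓔(t)) and feeds Chowla(M_𝓔) INTO root-number averages; the
2-parity theorem (DokchitserDokchitserAnnals2010 Thm 1.4, Monsky1996;
Literature.NumberTheory.EllipticCurves.p_parity) turns W into the parity of a
GLOBAL invariant, so polynomial Chowla/Bateman–Horn parity becomes a statement about 2^∞-Selmer
coranks (equivalently rank parity given Ш finite,
dim Sel₂ − dim E[2](ℚ) mod 2 by Cassels–Tate) of one elliptic surface per system; the route runs the
dictionary in REVERSE and the new,
checkable content is the universal pencil on which the dictionary is an exact identity with g ≡ −1
(Δ = F·(1728F+1)², all multiplicative fibres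
split, (−1|1728F+1) = 1 kills the additive odd part) — Helfgott's pliable g and square-part h
collapse to the explicit ε, ε′. Imported area:
arithmetic of elliptic curves — 2-descent / 2-coverings as locally soluble binary quartics with
invariants (I,J) = (c₄,2c₆)(F(t)) and their
geometry-of-numbers counts (BhargavaShankarAnnals2015; Literature BinaryQuartic*, BhargavaShankar*
files), parity as the relative position of the
global and adelic Lagrangians (PoonenRains2012), 2^∞-Selmer laws (arXiv:2503.17619) — pointed at the
parity atom, which PolynomialMobius (the only
other open BatemanHorn route) isolates but does not attack with any object from outside
multiplicative analysis. Known trap recorded: isogeny-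
Selmer counts of such pencils are divisor functions of F(t) (circular); the engine must see the full
Sel₂/Ш[2]. Negatives index (2026-08-15, 2
entries, both GeneralizedHardyLittlewood-side) touches no item here.

RANKED CRUXES. #2 PencilSelmerParity (crux) — for every N ≥ 1, (−1)^{corank_ℤ₂ Sel_2∞(E_N/ℚ)} =
−(−1)^{ω(N)}·ε(N), ε(N) = ∏_{p : v_p(1728N+1) ≡ 2,4 (mod 6)} (−3|p): the 2-parity theorem
(Dokchitser–Dokchitser 2010 Thm 1.4, (−1)^{corank Sel_p∞} = w(E)) composed with the product formula
w = −∏_p w_p (Deligne–Rohrlich; tree fact WeierstrassCurve.rootNumber_eq_algebraicRootNumber,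
applicable since E_N is semistable at 2, 3) and Rohrlich's local table on this model (w_p = −1 at p
∣ N, split multiplicative; at p ∣ 1728N+1, p ≥ 5, v = v_p(1728N+1), v_p(Δ_min) = 2(v mod 6): w_p =
(−1|p) for v odd, (−3|p) for v ≡ 2,4 (6), good for 6 ∣ v; ∏_{v odd}(−1|p) = (−1|1728N+1) = +1; w_∞ =
−1). Rev 1 (cone repair) merges rev 0's TwoParityPencil ((−1)^{corank} = algebraicRootNumber E_N)
and PencilRootNumber (algebraicRootNumber E_N = closed form) into this one statement over
WeierstrassCurve.selmerCorank + Mathlib, so the route imports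
Literature.NumberTheory.EllipticCurves.Selmer only. Filed as the FIRST crux because it is the
unproved (in Lean) theorem the mechanism rests on; it is not expected to be refuted, it is expected
to be CLOSED in a Theorems file from p_parity + rootNumber_eq_algebraicRootNumber (+ PencilReduction
and the Rohrlich case list of localRootNumber) once those Literature facts carry `_holds`.
[difficulty: XL] (why it might fail: theorem in print unless the hand local analysis slipped — PARI
ellrootno vs the closed form for N ≤ 3000 is the check (kit j001949; three independent hand
re-derivations by grounder g14-20, refuters g40-62, g41-24 agree); as a Lean item XL until p_parity
lands.) [DokchitserDokchitserAnnals2010, Monsky1996, Rohrlich1993Compositio,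
Helfgott2003RootNumbers, Literature.NumberTheory.EllipticCurves.p_parity,
WeierstrassCurve.rootNumber_eq_algebraicRootNumber]
#3 SelmerParityLevel (crux) — for every BH system f (k ≥ 1), F = ∏ f_i, every η ∈ (0,1), A > 0 and x
≥ x₀: Σ_{m ≤ x^{1−η}} Σ_{ρ mod m, m∣F(ρ)} max_{y≤x} |Σ_{t≤y, t≡ρ (m), F(t)>0}
ε(F(t))·ε′(F(t))·(−1)^{corank Sel_2∞(E_{F(t)})}| ≤ x/(log x)^A — the normalised Selmer parity of the
pencil is equidistributed along its multiplicative fibres (m ∣ F(t) ⇔ E_{F(t)} split multiplicative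
at all p ∣ m), uniformly in the conductor-part m ≤ x^{1−η} (card C1+C2 in the level form the tail
needs). By r2 the summand is −λ(F(t)). [deps: PencilSelmerParity] [difficulty: open-problem] (why it
might fail: Equals (given r2) level-(1−η) equidistribution of λ(F(t)) on root classes: the parity
atom for every system AND EH-range uniformity in m (LargeSieveLevelHalf); all known Selmer laws
(Heath-Brown, Kane, Bhargava–Shankar, Smith) need large families and read parity locally.)
[Helfgott2003RootNumbers, DokchitserDokchitserAnnals2010, BhargavaShankarAnnals2015,
PoonenRains2012, arXiv:2503.17619, Literature.Barriers.Parity.LargeSieveLevelHalf]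
#4 SelmerParityAtom (crux) — for every irreducible non-constant f with positive leading coefficient
and every q ≥ 1, a: Σ_{t≤x, t≡a (q), f(t)>0 squarefree} ε(f(t))·(−1)^{corank Sel_2∞(E_{f(t)})} =
o(x); by r2 this is literally Σ_{t≡a (q)} μ(f(t)) = o(x) (the Möbius atom of f in APs:
PolyMobiusAtom stmt-Parity-0871 along progressions; n²+1: stmt-Parity-0650/0615). The card's
headline equivalence, the first target of any torsor-counting engine, the cheapest statement to
test; linear f is PNT in APs (a warm-up provable from r2). [deps: PencilSelmerParity] [difficulty:
open-problem] (why it might fail: For deg f ≥ 2 it is polynomial Chowla (Möbius form) in APs, open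
for every nonlinear f (Teravainen2024 Conj. 1.2); as a Selmer statement no root-number-free
evaluation of parity on a thin pencil is known — a grounder may show every available formula is
Cassels/DD-local (circular).) [Teravainen2024, Chowla1965, Helfgott2003RootNumbers,
DokchitserDokchitserAnnals2010, Monsky1996, PoonenRains2012, stmt-Parity-0871]
#5 LiouvilleRootClassLevel (crux) — λ-side junction, for every BH system (k ≥ 1): ∀ η ∈ (0,1) ∀ A:
Σ_{m ≤ x^{1−η}} Σ_{ρ mod m, m∣F(ρ)} max_{y≤x} |Σ_{t≤y, t≡ρ (m), F(t)>0} λ(F(t))| ≤ x/(log x)^A for x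
≥ x₀ (on a root class F(ρ+ms) = m·G(s), so this is Liouville randomness of the cofactor polynomials
F(ρ+ms)/m, uniformly in m ≤ x^{1−η}: exactly the d₁⋯d_k > x^{1+…} ⇔ small-cofactor range of
PolyMobiusTail). Implied by r2 ∧ r3 (ParityToLiouville); stated as a crux because it is
independently attackable and refutable (Helfgott's Hypothesis 𝔅₁(F) is its (log x)^A-modulus case).
[difficulty: open-problem] (why it might fail: Contains Σ λ(F(n)) = o(x) for every BH product F
(Chowla 1965, open for deg ≥ 2) and asks level 1−η in the cofactor modulus — Elliott–Halberstam
range; a CCG-type bias over ℤ on one root class refutes it.) [Chowla1965, Teravainen2024,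
Helfgott2003RootNumbers, ConradConradGross2008, stmt-Parity-0872]
#6 TailGivenParity (crux) — LiouvilleRootClassLevel → PolyMobiusTail (route PolynomialMobius r2 =
stmt-Parity-0870, inlined verbatim): given the parity input on the small-cofactor range, the Möbius
tail Σ_{n≤x} Σ_{d_i∣f_i(n), ∏d_i > x^{1−η}} ∏ μ(d_i) log d_i = o(x) follows for every system — i.e.
the WINDOW range ∏d_i ∈ (x^{1−η}, x^{deg F−1+η}] (Möbius against counts of small roots; sub-dyadic,
log-weighted) plus the squarefree-sieve bookkeeping μ(d) = λ(f_i(n))λ(e)Σ_{r²∣d}μ(r) that transfers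
λ-input to μ of cofactors (tails r > x^{η/4} by Estermann-type counts of large square divisors).
[deps: LiouvilleRootClassLevel] [difficulty: open-problem] (why it might fail: The window for deg F
≥ 3 is the CubicRoots/QuarticRoots problem (Hooley 1964: only (log D)^{−δ} for roots of cubics; no
Type II in thin sets, FordMaynardLowLevel); even for n²+1 the balanced range mn ~ x is beyond print
(arXiv:2505.00493 Thm 1.5).) [Merikoski2022, arXiv:2505.00493, DukeFriedlanderIwaniec1995,
Hooley1976, stmt-Parity-0870, Literature.Barriers.Parity.FordMaynardLowLevel]
#9 PencilReduction (support) — Mathlib-only local algebra of the pencil (the Tate-algorithm half of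
rev 0's PencilRootNumber): for N ≥ 1 and every prime p, the model ⟨1,0,0,−36N,−N⟩ over ℚ_p has split
multiplicative reduction over ℤ_p when p ∣ N (v_p(c₄) = 0 so the model is minimal; tangent
polynomial ≡ T(T+1)), good reduction when p ∤ N(1728N+1), and for p ∣ 1728N+1 (p ≥ 5, v =
v_p(1728N+1): v_p(c₄) = v_p(c₆) = v, v_p(Δ) = 2v, v_p(Δ_min) = 2(v mod 6)) its ℤ_p-minimal model has
additive reduction when 6 ∤ v and good reduction when 6 ∣ v. Provable now with effort
(WeierstrassCurve.IsMinimal via MaximalFor and the u-scaling of c₄, Δ; Silverman AEC VII.1, VII.5).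
[difficulty: L] [SilvermanAEC2009, Rohrlich1993Compositio, Helfgott2003RootNumbers]
#9 TypeIMainTerm (support) — Type-I main term for every system (shared verbatim with
PolynomialMobius, stmt-Parity-0873). [difficulty: L] [BatemanHorn1962, stmt-Parity-0873]
#9 LambdaToCount (support) — from Λ-weights to the prime count (shared verbatim with
PolynomialMobius, stmt-Parity-0874). [difficulty: M] [BatemanHorn1962, stmt-Parity-0874]
#9 ParityToLiouville (support) — glue, provable now (replaces rev 0's SelmerToLiouville, whose
candidate proof SelmerGlue.lean by refuter g40-62 adapts by deleting the algebraicRootNumber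
rewriting): PencilSelmerParity → SelmerParityLevel → LiouvilleRootClassLevel. For F(t) = N ≥ 1:
ε(N)ε′(N)(−1)^{corank} = −ε²·(−1)^{ω(N)}ε′(N) = −λ(N) since ε = ±1 (p ∣ 1728N+1 ⇒ p ∤ 3) and
(−1)^{ω}ε′ = ∏_{p∣N}(−1)^{v_p} = λ; so the two inner sums agree up to sign inside |·|. [difficulty:
provable-now] [DokchitserDokchitserAnnals2010, Helfgott2003RootNumbers]
#9 TailToBatemanHorn (support) — PolyMobiusTail (inlined) → TypeIMainTerm → LambdaToCount →
BatemanHorn: the bookkeeping of route PolynomialMobius (definitionally its assembly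
stmt-Parity-0875: ∏Λ(f_i(n)) = (−1)^k Σ_{d_i∣f_i(n)} ∏μ(d_i) log d_i by
ArithmeticFunction.sum_moebius_mul_log_eq, split at ∏d_i ≤ x^{1−η}, IsEquivalent.add_isLittleO, then
LambdaToCount and BatemanHornConjecture = ∀ k f, IsBatemanHornSystem f → BatemanHornAsymptotic f).
Provable now. [difficulty: provable-now] [BatemanHorn1962, stmt-Parity-0875]

TWO-LAYER PLAN. Foreseen glued splits (none filed now): PencilSelmerParity ⇐ [p_parity_holds ∧
rootNumber_eq_algebraicRootNumber_holds as Literature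
facts: (−1)^{corank} = algebraicRootNumber E_N, rev 0's TwoParityPencil] → [algebraicRootNumber E_N
= closed form, rev 0's PencilRootNumber, from
PencilReduction + the Rohrlich case list of localRootNumber] — a split that re-introduces
RootNumber.lean only inside Theorems files, never in the
route's cone; SelmerParityLevel ⇐ SelmerParityAtom-type equidistribution on fixed fibre classes → a
transfer lemma to level x^{1/2−η} (large-sieve
range) → the EH-range piece m ∈ (x^{1/2}, x^{1−η}] (by divisor switching a window statement; may
migrate to r6); SelmerParityAtom ⇐ [root-number-free
formula for dim Sel₂(E_{f(t)}) mod 2: signed count of GL₂(ℤ)-classes of locally soluble quartics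
with (I,J) = (1728f(t)+1, −2(1728f(t)+1)) up to the
standard normalisation, or the O/SO-component of the pair of Lagrangians à la Poonen–Rains] →
[equidistribution of that count along t (geometry of
numbers on the invariant curve I³ − J²/4-type pencil)]; TailGivenParity ⇐ [window for deg F = 2
(n²+1: sub-dyadic (W), stmt-Parity-0648 strengthened)]
→ [deg ≥ 3 windows (CubicRoots-type inputs)] → [squarefree-sieve bookkeeping].

KILL CRITERIA. PencilSelmerParity's closed form contradicted by PARI (ellrootno(E_N) ≠
−(−1)^{ω(N)}ε(N) for some N — by the 2-parity theorem in print the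
two sides must agree) or PencilReduction refuted (elllocalred) ⇒ the local analysis slipped ⇒
re-derive ε and restate r2–r4 (pivot; same frame).
SelmerParityAtom refuted for some f (a bias of Selmer parity = a bias of μ(f(t)) in an AP — a
CCG-type phenomenon over ℤ) ⇒ ¬PolyMobiusAtom-in-APs for
that f ⇒ close `refuted:SelmerParityAtom` and flag BatemanHorn for f summit-wide.
LiouvilleRootClassLevel refuted only in the EH range ⇒ resplit as
in the two-layer plan. TailGivenParity can only die with PolyMobiusTail (then both routes close).
PencilSelmerParity itself is a theorem in print
(DD2010 Thm 1.4 + product formula + Rohrlich); if graders rule such cruxes inadmissible ⇒ convert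
the route to a conditional bridge on p_parity. A
grounder's proof that every Selmer-parity evaluation on the pencil factors through local constants
empties the mechanism (route dormant) but refutes
no item. PolyMobiusTail proved elsewhere moots r5/r6 and leaves r3/r4 as corollaries-in-waiting.

NOT DECOMPOSED YET. The torsor-counting formula (which signed count of 2-coverings of E_{F(t)}
computes the Selmer parity without local constants) —
layer 2 under r4; the split of r2 into (2-parity ∘ product formula) + (local root-number
computation) described in the two-layer plan (filed only
once p_parity / rootNumber_eq_algebraicRootNumber carry `_holds`, so that RootNumber.lean never
re-enters the cone unproved); the window cruxes per
degree (inside r6); rank-parity / Ш[2] variants of r4 (conditional on finiteness of Ш); the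
rational-parameter (two-variable) pencil where Helfgott's
averages are unconditional for deg ≤ 3; numerical constants (none: g ≡ −1).

CHEAPEST FALSIFIER. PARI, minutes: for N ≤ 3000, ellrootno(ellinit([1,0,0,−36N,−N])) ==
−(−1)^omega(N)·∏_{v_p(1728N+1) ≡ 2,4 mod 6} kronecker(−3,p)
and elllocalred types (split I_n at p ∣ N, additive at p ∣ 1728N+1 with 6 ∤ v, good otherwise), plus
the identity ε·ε′·w = −λ(t²+1) for t ≤ 2000
(submitted from this seat as kit job j001949, script kit/rootno.gp, evidence auto-attaches to the
route; earlier identical certificates j001362 /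
j001439 / j001446 by grounder g14-20 and refuters g41-24, g40-62 attach to stmt-Parity-9650); then
Σ_{t≤x, t≡a (q)} of the r4 summand for f = t²+1,
q ≤ 12, x = 10⁴ via ellrootno (2-parity) — no bias expected (μ(n²+1) numerics on stmt-Parity-0615:
0.017 … −0.0004). Lean-side: Δ, c₄, c₆ of E_N
verified by `ring` (Sketch.lean; grounder evidence PencilInvariants.lean on stmt-Parity-9650).

NUMBERS. E_N invariants: b₂ = 1, b₄ = −72N, b₆ = −4N, c₄ = 1728N+1, c₆ = −(1728N+1), Δ =
N(1728N+1)², j = 1728 + 1/N; (I,J) of the 2-covering quartics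
∝ (c₄, 2c₆). Density of t with ε(F(t)) ≠ 1 (some p² ∣ 1728F(t)+1, p ≥ 5): ≤ Σ_{p≥5} ω(p²)/p² ≈ a few
%; with ε′ ≠ 1 (p² ∣ F(t)): 1 − ∏(1 −
ω_F(p²)/p²). Level needed: m ≤ x^{1−η} for every η (EH range); large-sieve range m ≤ x^{1/2−η}.
Items after rev 1: 11 (5 cruxes, 5 supports,
assembly; `closes` decides). Cone: imports Literature.NumberTheory.EllipticCurves.Selmer (11
Literature modules) instead of …BSDSelmer (25);
dependency cone of the items 49 project constants, 0 unproved facts below the target.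

DEFINITION REQUESTS. None blocking; needs-fact: none (no item depends on an unproved Literature
fact). Wanted as Literature facts with `_holds`
eventually, to CLOSE r2 (not to state it): Literature.NumberTheory.EllipticCurves.p_parity (DD2010
Thm 1.4), WeierstrassCurve.rootNumber_eq_algebraicRootNumber
(Deligne–Rohrlich). Cite wants already filed for the retired predecessor and still useful elsewhere:
wi-19073 (local constancy of local root
numbers, Helfgott2004RootNumberFamilies Prop. 4.2–4.3) and the Kellock–Dokchitser ℚ₂ tables — NOT
needed by this route (E_N is semistable at 2, 3).

Novelty: Searches (2026-08-15): `lit search --source s2 "root numbers elliptic curves one-parameter families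
average"` (15: Helfgott 2003/2004, Rizzo 1999,
Bettin–David–Delaunay 2016, Desjardins 2018, Chinis 2017, Diao arXiv:2608.10702, Miller et al.);
`lit search --source zbmath "root numbers parity
problem elliptic curves families Liouville polynomial"` (0); `lit search --hybrid "root number
elliptic surface family Liouville parity Helfgott"`
(vector noise); `lit galaxy search "average root number" --star all` (18 rows, 1 relevant:
Bettin–David–Delaunay hal-01478267); `lit galaxy search
"Selmer parity" / "root number Liouville elliptic surface" --star all` (0 each); openalex/arxiv legs
rate-limited (429); `lit read arxiv:math/0305435`
(Prop. 5.1, 5.4, Lemma 5.2–5.3, Thm 7.1–7.4) and `arxiv:math/0408141` (Prop. 4.2); card audit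
refuter-novelty-audit-Parity-BatemanHorn-1-0 (zbMATH →
Helfgott, Desjardins 2019, Conrad–Conrad–Helfgott 2005).
Nearest prior art found: Helfgott2003RootNumbers (arXiv:math/0305435) Prop. 5.4 / Thm 7.1 — the
FORWARD direction (Chowla ⇒ root numbers average
to 0) with pliable g and a square-part factor h; DokchitserDokchitserAnnals2010 Thm 1.4; Rizzo 1999
/ Bettin–David–Delaunay 2016 / Desjardins 2018
(root-number averages in families, all via local formulas); BhargavaShankarAnnals2015,
arXiv:2503.17619 (Selmer laws in LARGE families).
Delta: the reverse direction on a universal pencil E_{F(t)} (j = 1728 + 1/F) for which the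
dictionary is the exact identity w =  [refs: 2608.10702, math/0305435, math/0408141, 2503.17619, arxiv:math/0305435, arxiv:math/0408141, DokchitserDokchitserAnnals2010, BhargavaShankarAnnals2015]

Barriers (technique_class: selmer-parity root-number transfer, torsor-counting): - technique_class: selmer-parity root-number transfer, torsor-counting
- Literature.Barriers.Parity.FunctionFieldMobiusBias: consistent and not evaded by force — over
𝔽_q[u] the CCG bias lives in inseparable f and the dictionary transports it faithfully
(constant-root-number families, Conrad–Conrad–Helfgott 2005); over ℤ every f is separable and r3/r4
are EQUIVALENT to Liouville/Möbius statements by two theorems, so no false transfer of the local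
heuristic is used; a genuine ℤ-analogue of the bias would refute r4/r5 (kill criterion).
- Literature.Barriers.Parity.SelbergParityBarrier: evaded in kind — no Type-I sieve bound is asked
to produce primes; the parity content is isolated in r3/r4 as a statement about a global invariant
(Selmer corank) and Type-I (TypeIMainTerm) covers only ∏d_i ≤ x^{1−η}.
- Literature.Barriers.Parity.LargeSieveLevelHalf: it does not evade it; the bet is that uniformity
in the conductor-part m ≤ x^{1−η} (EH range) comes from the algebraic variation of torsor counts
with t, not from a large-sieve inequality — the two-layer plan isolates the m ≤ x^{1/2−η} piece
where the large sieve would do.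
- Literature.Barriers.Parity.FordMaynardLowLevel: applies to Type-I/II prime-detecting sieves in
thin polynomial value sets (c ≥ 1/2); the route detects no primes by Type II — its Type-II-like
content sits in r6 (windows), which does not evade the minimal-Type-II width but asks for it, and
its parity input is r3.
- Literature.Barriers.Parity.FordFixedLevelBarrier:

History (route lifecycle, newest last):
- 2026-08-15T17:00:45Z · rev 1: restated Assembly (stmt-Parity-9653) — cone repair (rrepair g2): imports BSDSelmer→Selmer; r2+PencilRootNumber merged into PencilSelmerParity (selmerCorank+Mathlib only); SelmerToLiouville→ParityToLi (planner-rrepair-Parity-SelmerPencil-caac3982-g2-0)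
- 2026-08-15T17:00:45Z · rev 1: dropped TwoParityPencil, PencilRootNumber, SelmerToLiouville — cone repair (rrepair g2): imports BSDSelmer→Selmer; r2+PencilRootNumber merged into PencilSelmerParity (selmerCorank+Mathlib only); SelmerToLiouville→ParityToLi (planner-rrepair-Parity-SelmerPencil-caac3982-g2-0)
- 2026-08-24T04:10:10Z · DORMANT — reconciler: no traction for 6.5 d (last activity item-evidence-added at 2026-08-17T14:59:41Z); parked, not closed — `ledger route dormant route-Parity-SelmerPen (operator:999:40132)

sub-problem: BatemanHorn · status: dormant · opened planner-plancard-Parity-BatemanHorn-selmer-pa-f7698059-0 2026-08-15T14:07:41Z · rev 2 · ledger route-Parity-SelmerPencil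
GENERATED by the gate from the ledger (D-0016/17). Provers cite these decls: `theorem foo : Summit.Parity.BatemanHorn.Theses.SelmerPencil.<Decl> := …` in Summits/Parity/BatemanHorn/Theorems/<Name>.lean.
-/

namespace Summit.Parity.BatemanHorn.Theses.SelmerPencil

open scoped BigOperators Topology Manifold Classical MeasureTheory ProbabilityTheory Matrix InnerProductSpace ComplexConjugate ContinuousMap
open Filter Set Function TopologicalSpace MeasureTheory

attribute [summit_statement] _root_.BatemanHorn

/-- item stmt-Parity-11296 · crux · rank 2 · open · by planner
why it might fail: Theorem in print (DD2010 Thm 1.4 + product formula + Rohrlich 1993 Prop. 2) unless the hand local analysis of E_N slipped — PARI ellrootno vs closed form for N ≤ 3000 (kit j001949; 3 independent re-derivations agree) is the check; as a Lean item XL until p_parity lands.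
sources: DokchitserDokchitserAnnals2010, Monsky1996, Rohrlich1993Compositio, Helfgott2003RootNumbers, Literature.NumberTheory.EllipticCurves.p_parity, WeierstrassCurve.rootNumber_eq_algebraicRootNumber
[crux] for every N ≥ 1, (−1)^{corank_ℤ₂ Sel_2∞(E_N/ℚ)} = −(−1)^{ω(N)}·ε(N), ε(N) := ∏_{p :
v_p(1728N+1) ≡ 2,4 (mod 6)} (−3|p), for the pencil E_N : y² + xy = x³ − 36N·x − N: the 2-parity
theorem (Dokchitser–Dokchitser 2010 Thm 1.4, (−1)^{corank Sel_p∞(E/ℚ)} = w(E)) composed with the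
product formula w(E) = −∏_p w_p(E) (Deligne–Rohrlich; tree fact
WeierstrassCurve.rootNumber_eq_algebraicRootNumber, applicable since E_N is semistable at 2 and 3)
and Rohrlich's local table on this explicit model (p ∣ N: split multiplicative, w_p = −1; p ∣
1728N+1: p ≥ 5, additive potentially good, v = v_p(1728N+1), v_p(Δ_min) = 2(v mod 6), w_p = (−1|p)
for v odd, (−3|p) for v ≡ 2,4 (6), +1 for 6 ∣ v; ∏_{v odd}(−1|p) = (−1|1728N+1) = +1 as 1728N+1 ≡ 1
(4); w_∞ = −1). Cone repair rev 1: replaces rev 0's TwoParityPencil ((−1)^{corank} =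
algebraicRootNumber E_N) ∧ PencilRootNumber (algebraicRootNumber E_N = closed form), typed over
WeierstrassCurve.selmerCorank + Mathlib only so that the route imports
Literature.NumberTheory.EllipticCurves.Selmer and nothing from RootNumber/BSDSelmer. A theorem in
print, unproved in Lean; expected to be closed in a Theorems file from p_parity +
rootNumber_eq_algebraicRootN -/
@[route_item "route-Parity-SelmerPencil", crux]
def PencilSelmerParity : Prop :=
  ∀ N : ℕ, 1 ≤ N → (-1 : ℤ) ^ (WeierstrassCurve.selmerCorank (⟨1, 0, 0, -36 * (N : ℚ), -(N : ℚ)⟩ : WeierstrassCurve ℚ) 2) = -((-1 : ℤ) ^ ArithmeticFunction.cardDistinctFactors N * ∏ p ∈ (1728 * N + 1).primeFactors, (if padicValNat p (1728 * N + 1) % 6 = 2 ∨ padicValNat p (1728 * N + 1) % 6 = 4 then jacobiSym (-3) p else 1))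

/-- item stmt-Parity-9646 · crux · rank 3 · open · by planner
why it might fail: Equals (given r2 + PencilRootNumber) level-(1−η) equidistribution of λ(F(t)) on root classes: the parity atom for every system AND EH-range uniformity in m (LargeSieveLevelHalf); all known Selmer laws (Heath-Brown, Kane, Bhargava–Shankar, Smith) need large families and read parity locally.
sources: Helfgott2003RootNumbers, DokchitserDokchitserAnnals2010, BhargavaShankarAnnals2015, PoonenRains2012, arXiv:2503.17619, Literature.Barriers.Parity.LargeSieveLevelHalf
[crux] for every BH system f (k ≥ 1), F = ∏ f_i, every η ∈ (0,1), A > 0 and x ≥ x₀: Σ_{m ≤ x^{1−η}}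
Σ_{ρ mod m, m∣F(ρ)} max_{y≤x} |Σ_{t≤y, t≡ρ (m), F(t)>0} ε(F(t))·ε′(F(t))·(−1)^{corank
Sel_2∞(E_{F(t)})}| ≤ x/(log x)^A — the normalised Selmer parity of the pencil is equidistributed
along its multiplicative fibres (m ∣ F(t) ⇔ E_{F(t)} split multiplicative at all p ∣ m), uniformly
in the conductor-part m ≤ x^{1−η} (card C1+C2 in the level form the tail needs). By r2 +
PencilRootNumber the summand is −λ(F(t)). [deps: TwoParityPencil] [difficulty: open-problem] -/
@[route_item "route-Parity-SelmerPencil", crux]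
def SelmerParityLevel : Prop :=
  ∀ (k : ℕ) (f : Fin k → Polynomial ℤ), 0 < k → Literature.NumberTheory.Sieve.IsBatemanHornSystem f → ∀ η : ℝ, 0 < η → η < 1 → ∀ A : ℝ, 0 < A → ∃ x₀ : ℕ, ∀ x : ℕ, x₀ ≤ x → ∀ y : ℕ → ℕ → ℕ, (∀ m ρ, y m ρ ≤ x) → ∑ m ∈ Finset.Icc 1 ⌊(x : ℝ) ^ (1 - η)⌋₊, ∑ ρ ∈ (Finset.range m).filter (fun ρ : ℕ => (m : ℤ) ∣ (∏ i, f i).eval (ρ : ℤ)), |∑ t ∈ (Finset.Icc 1 (y m ρ)).filter (fun t : ℕ => t ≡ ρ [MOD m] ∧ 0 < (∏ i, f i).eval (t : ℤ)), (((∏ p ∈ (1728 * ((∏ i, f i).eval (t : ℤ)).toNat + 1).primeFactors, (if padicValNat p (1728 * ((∏ i, f i).eval (t : ℤ)).toNat + 1) % 6 = 2 ∨ padicValNat p (1728 * ((∏ i, f i).eval (t : ℤ)).toNat + 1) % 6 = 4 then jacobiSym (-3) p else 1)) * (∏ p ∈ (((∏ i, f i).eval (t : ℤ)).toNat).primeFactors,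 (-1 : ℤ) ^ (padicValNat p (((∏ i, f i).eval (t : ℤ)).toNat) + 1)) * (-1 : ℤ) ^ (WeierstrassCurve.selmerCorank (⟨1, 0, 0, -36 * ((((∏ i, f i).eval (t : ℤ)).toNat : ℕ) : ℚ), -((((∏ i, f i).eval (t : ℤ)).toNat : ℕ) : ℚ)⟩ : WeierstrassCurve ℚ) 2) : ℤ) : ℝ)| ≤ (x : ℝ) / Real.log x ^ A

/-- item stmt-Parity-9647 · crux · rank 4 · open · by planner
why it might fail: For deg f ≥ 2 it is polynomial Chowla (Möbius form) in APs, open for every nonlinear f (Teravainen2024 Conj. 1.2); as a Selmer statement no root-number-free evaluation of parity on a thin pencil is known — a grounder may show every available formula is Cassels/DD-local (circular).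
sources: Teravainen2024, Chowla1965, Helfgott2003RootNumbers, DokchitserDokchitserAnnals2010, Monsky1996, PoonenRains2012
[crux] for every irreducible non-constant f with positive leading coefficient and every q ≥ 1, a:
Σ_{t≤x, t≡a (q), f(t)>0 squarefree} ε(f(t))·(−1)^{corank Sel_2∞(E_{f(t)})} = o(x); by r2 +
PencilRootNumber this is literally Σ_{t≡a (q)} μ(f(t)) = o(x) (the Möbius atom of f in APs:
PolyMobiusAtom stmt-Parity-0871 along progressions; n²+1: stmt-Parity-0650/0615). The card's
headline equivalence, the first target of any torsor-counting engine, the cheapest statement to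
test; linear f is PNT in APs (a warm-up provable from the two facts). [deps: TwoParityPencil]
[difficulty: open-problem] -/
@[route_item "route-Parity-SelmerPencil", crux]
def SelmerParityAtom : Prop :=
  ∀ f : Polynomial ℤ, Irreducible f → 1 ≤ f.natDegree → 0 < f.leadingCoeff → ∀ q a : ℕ, 0 < q → (fun x : ℕ => ∑ t ∈ (Finset.Icc 1 x).filter (fun t : ℕ => t ≡ a [MOD q] ∧ 0 < f.eval (t : ℤ) ∧ Squarefree (f.eval (t : ℤ)).toNat), (((∏ p ∈ (1728 * (f.eval (t : ℤ)).toNat + 1).primeFactors, (if padicValNat p (1728 * (f.eval (t : ℤ)).toNat + 1) % 6 = 2 ∨ padicValNat p (1728 * (f.eval (t : ℤ)).toNat + 1) % 6 = 4 then jacobiSym (-3) p else 1)) * (-1 : ℤ) ^ (WeierstrassCurve.selmerCorank (⟨1, 0, 0, -36 * (((f.eval (t : ℤ)).toNat : ℕ) : ℚ), -(((f.eval (t : ℤ)).toNat : ℕ) : ℚ)⟩ : WeierstrassCurve ℚ) 2) : ℤ) : ℝ)) =o[atTop] fun x : ℕ => (x : ℝ)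

/-- item stmt-Parity-9648 · crux · rank 5 · open · by planner
why it might fail: Contains Σ λ(F(n)) = o(x) for every BH product F (Chowla 1965, open for deg ≥ 2) and asks level 1−η in the cofactor modulus — Elliott–Halberstam range; a CCG-type bias over ℤ on one root class refutes it.
sources: Chowla1965, Teravainen2024, Helfgott2003RootNumbers, ConradConradGross2008, stmt-Parity-0872
[crux] λ-side junction, for every BH system (k ≥ 1): ∀ η ∈ (0,1) ∀ A: Σ_{m ≤ x^{1−η}} Σ_{ρ mod m,
m∣F(ρ)} max_{y≤x} |Σ_{t≤y, t≡ρ (m), F(t)>0} λ(F(t))| ≤ x/(log x)^A for x ≥ x₀ (on a root class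
F(ρ+ms) = m·G(s), so this is Liouville randomness of the cofactor polynomials F(ρ+ms)/m, uniformly
in m ≤ x^{1−η}: exactly the d₁⋯d_k > x^{1+…} ⇔ small-cofactor range of PolyMobiusTail). Implied by
r2 ∧ r3 ∧ PencilRootNumber (SelmerToLiouville); stated as a crux because it is independently
attackable and refutable (Helfgott's Hypothesis 𝔅₁(F) is its (log x)^A-modulus case). [difficulty:
open-problem] -/
@[route_item "route-Parity-SelmerPencil", crux]
def LiouvilleRootClassLevel : Prop :=
  ∀ (k : ℕ) (f : Fin k → Polynomial ℤ), 0 < k → Literature.NumberTheory.Sieve.IsBatemanHornSystem f → ∀ η : ℝ, 0 < η → η < 1 → ∀ A : ℝ, 0 < A → ∃ x₀ : ℕ, ∀ x : ℕ, x₀ ≤ x → ∀ y : ℕ → ℕ → ℕ, (∀ m ρ, y m ρ ≤ x) → ∑ m ∈ Finset.Icc 1 ⌊(x : ℝ) ^ (1 - η)⌋₊, ∑ ρ ∈ (Finset.range m).filter (fun ρ : ℕ => (m : ℤ) ∣ (∏ i, f i).eval (ρ : ℤ)), |∑ t ∈ (Finset.Icc 1 (y m ρ)).filter (fun t : ℕ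 => t ≡ ρ [MOD m] ∧ 0 < (∏ i, f i).eval (t : ℤ)), (ArithmeticFunction.liouville (((∏ i, f i).eval (t : ℤ)).toNat) : ℝ)| ≤ (x : ℝ) / Real.log x ^ A

/-- item stmt-Parity-9649 · crux · rank 6 · open · by planner
why it might fail: The window for deg F ≥ 3 is the CubicRoots/QuarticRoots problem (Hooley 1964: only (log D)^{−δ} for roots of cubics; no Type II in thin sets, FordMaynardLowLevel); even for n²+1 the balanced range mn ~ x is beyond print (arXiv:2505.00493 Thm 1.5).
sources: Merikoski2022, arXiv:2505.00493, DukeFriedlanderIwaniec1995, Hooley1976, stmt-Parity-0870, Literature.Barriers.Parity.FordMaynardLowLevel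
[crux] LiouvilleRootClassLevel → PolyMobiusTail (route PolynomialMobius r2 = stmt-Parity-0870,
inlined verbatim): given the parity input on the small-cofactor range, the Möbius tail Σ_{n≤x}
Σ_{d_i∣f_i(n), ∏d_i > x^{1−η}} ∏ μ(d_i) log d_i = o(x) follows for every system — i.e. the WINDOW
range ∏d_i ∈ (x^{1−η}, x^{deg F−1+η}] (Möbius against counts of small roots; sub-dyadic,
log-weighted) plus the squarefree-sieve bookkeeping μ(d) = λ(f_i(n))λ(e)Σ_{r²∣d}μ(r) that transfers
λ-input to μ of cofactors (tails r > x^{η/4} by Estermann-type counts of large square divisors).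
[deps: LiouvilleRootClassLevel] [difficulty: open-problem] -/
@[route_item "route-Parity-SelmerPencil", crux]
def TailGivenParity : Prop :=
  LiouvilleRootClassLevel → ∀ (k : ℕ) (f : Fin k → Polynomial ℤ), Literature.NumberTheory.Sieve.IsBatemanHornSystem f → ∃ η : ℝ, 0 < η ∧ η < 1 ∧ (fun x : ℕ => ∑ n ∈ Finset.Icc 1 x, ∑ d ∈ Fintype.piFinset (fun i => (((f i).eval (n : ℤ)).toNat).divisors), if (x : ℝ) ^ (1 - η) < ∏ i, (d i : ℝ) then ∏ i, ((ArithmeticFunction.moebius (d i) : ℝ) * Real.log (d i)) else 0) =o[Filter.atTop] fun x : ℕ => (x : ℝ)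

/-- item stmt-Parity-0873 · support · rank 9 · closed · proved by Summit.Parity.BatemanHorn.Theorems.typeIMainTerm_proof (prover) · by planner
sources: BatemanHorn1962, stmt-Parity-0873
[support] Type-I main term, theorem-grade: for every BH system f and η ∈ (0,1) there is C with
HasBatemanHornConst f C and (−1)^k ∑_{n≤x} ∑_{d_i | f_i(n), d_1⋯d_k ≤ x^{1−η}} ∏ μ(d_i) log d_i ~
C·x. Proof sketch: #{n ≤ x : d_i | f_i(n) ∀ i} = x ρ(d)/lcm(d) + O(ρ(d)) (period lcm(d) ≤ x^{1−η});
the log-weighted singular series (−1)^k ∑_d ∏(μ(d_i) log d_i) ρ(d)/lcm(d) converges (ordered by the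
cutoff) to the Bateman–Horn constant C(f) = ∏_p (1−1/p)^{−k}(1−ω(p)/p) by the prime ideal theorem
with error term in the splitting fields (Landau1903; BatemanHorn1962 §2; DavenportSchinzel1966; k =
1, f = X: −∑ μ(d) log d/d = 1). Named fact available:
Literature.NumberTheory.Sieve.exists_hasBatemanHornConst. Provable with substantial effort;
grounders may propose the needed Dedekind-zeta facts as Literature cites. -/
@[route_item "route-Parity-SelmerPencil", crux]
def TypeIMainTerm : Prop :=
  ∀ (k : ℕ) (f : Fin k → Polynomial ℤ), Literature.NumberTheory.Sieve.IsBatemanHornSystem f → ∀ η : ℝ, 0 < η → η < 1 → ∃ C : ℝ, 0 < C ∧ Literature.NumberTheory.Sieve.HasBatemanHornConst f C ∧ Asymptotics.IsEquivalent Filter.atTop (fun x : ℕ => (-1 : ℝ) ^ k * ∑ n ∈ Finset.Icc 1 x, ∑ d ∈ Fintype.piFinset (fun i => (((f i).eval (n : ℤ)).toNat).divisors), if ∏ i, (d i : ℝ) ≤ (x : ℝ) ^ (1 - η) then ∏ i, ((ArithmeticFunction.moebius (d i) : ℝ) * Real.log (d i)) else 0) (fun x : ℕ => C * (x : ℝ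))

/-- item stmt-Parity-0874 · support · rank 9 · closed · proved by Summit.Parity.BatemanHorn.LambdaToCount.lambdaToCount_proof (prover) · by planner
sources: BatemanHorn1962, stmt-Parity-0874
[support] From Λ-weights to the count, theorem-grade: if ∑_{n≤x} ∏_i Λ(f_i(n)) ~ C·x with
HasBatemanHornConst f C then BatemanHornAsymptotic f (polyPrimeCount f x ~ C/(∏ deg f_i) · x/(log
x)^k). Partial summation (Λ(f_i(n)) = log f_i(n) = deg f_i · log n + O(1) at prime values) plus
negligibility of proper prime-power values f_i(n) = p^a, a ≥ 2: O(x^{1/2+ε}) — trivial for deg ≤ 2,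
Bombieri–Pila / Siegel integral points on y^a = f_i(x) for deg ≥ 3. C > 0 by
Literature.NumberTheory.Sieve.exists_hasBatemanHornConst. -/
@[route_item "route-Parity-SelmerPencil", crux]
def LambdaToCount : Prop :=
  ∀ (k : ℕ) (f : Fin k → Polynomial ℤ), Literature.NumberTheory.Sieve.IsBatemanHornSystem f → ∀ C : ℝ, 0 < C → Literature.NumberTheory.Sieve.HasBatemanHornConst f C → Asymptotics.IsEquivalent Filter.atTop (fun x : ℕ => ∑ n ∈ Finset.Icc 1 x, ∏ i, ArithmeticFunction.vonMangoldt (((f i).eval (n : ℤ)).toNat)) (fun x : ℕ => C * (x : ℝ)) → Literature.NumberTheory.Sieve.BatemanHornAsymptotic f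

/-- item stmt-Parity-11297 · support · rank 9 · open · by planner
sources: SilvermanAEC2009, Rohrlich1993Compositio, Helfgott2003RootNumbers
[support] Mathlib-only local algebra of the pencil (the Tate-algorithm half of rev 0's
PencilRootNumber; vocabulary WeierstrassCurve.HasSplitMultiplicativeReduction / HasGoodReduction /
HasAdditiveReduction / minimal over ℤ_[p] ⊂ ℚ_[p]): for N ≥ 1 and every prime p, the model
⟨1,0,0,−36N,−N⟩ over ℚ_p (i) has split multiplicative reduction over ℤ_p when p ∣ N (v_p(c₄) = 0, so
the model is minimal and multiplicative; the tangent polynomial c₄T² + a₁c₄T − (54b₆ − 3b₂b₄ + a₂c₄)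
≡ T(T+1) mod p splits — p = 2, 3 included), (ii) has good reduction when p ∤ N(1728N+1) (v_p(Δ) =
0), and for p ∣ 1728N+1 (so p ≥ 5; v := v_p(1728N+1), v_p(c₄) = v_p(c₆) = v, v_p(Δ) = 2v, hence
v_p(Δ_min) = 2v − 12⌊v/6⌋ = 2(v mod 6) and v_p(c₄,min) = v − 4⌊v/6⌋ ≥ 1) its ℤ_p-minimal model (iii)
has additive reduction when 6 ∤ v and (iv) good reduction when 6 ∣ v. Invariants b₂ = 1, b₄ = −72N,
b₆ = −4N, c₄ = 1728N+1, c₆ = −(1728N+1), Δ = N(1728N+1)² (`ring`, planner Sketch.lean). Silverman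
AEC VII.1 (minimality criterion for p ≥ 5), VII.5; provable now with effort (IsMinimal via
MaximalFor needs the u^{−4}/u^{−12} scaling of c₄/Δ under VariableChange). PARI elllocalred check in
kit j001949. [difficulty: L] -/
@[route_item "route-Parity-SelmerPencil", crux]
def PencilReduction : Prop :=
  ∀ N : ℕ, 1 ≤ N → ∀ (p : ℕ) [Fact p.Prime], (p ∣ N → (⟨1, 0, 0, -36 * (N : ℚ_[p]), -(N : ℚ_[p])⟩ : WeierstrassCurve ℚ_[p]).HasSplitMultiplicativeReduction ℤ_[p]) ∧ (¬ p ∣ N * (1728 * N + 1) → (⟨1, 0, 0, -36 * (N : ℚ_[p]), -(N : ℚ_[p])⟩ : WeierstrassCurve ℚ_[p]).HasGoodReduction ℤ_[p]) ∧ (p ∣ 1728 * N + 1 → ¬ 6 ∣ padicValNat p (1728 * N + 1) → ((⟨1, 0, 0, -36 * (N : ℚ_[p]), -(N : ℚ_[p])⟩ : WeierstrassCurve ℚ_[p]).minimal ℤ_[p]).HasAdditiveReduction ℤ_[p]) ∧ (p ∣ 1728 * N + 1 → 6 ∣ padicValNat p (1728 * N + 1) → ((⟨1, 0, 0, -36 *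 (N : ℚ_[p]), -(N : ℚ_[p])⟩ : WeierstrassCurve ℚ_[p]).minimal ℤ_[p]).HasGoodReduction ℤ_[p])

/-- item stmt-Parity-11298 · support · rank 9 · open · by planner
sources: DokchitserDokchitserAnnals2010, Helfgott2003RootNumbers
[support] glue, provable now (replaces rev 0's SelmerToLiouville; its candidate proof
SelmerGlue.lean by refuter g40-62 adapts by deleting the algebraicRootNumber rewriting step):
PencilSelmerParity → SelmerParityLevel → LiouvilleRootClassLevel. For F(t) = N ≥ 1:
ε(N)·ε′(N)·(−1)^{corank Sel_2∞(E_N)} = −ε(N)²·(−1)^{ω(N)}·ε′(N) = −λ(N), since ε(N) = ±1 (p ∣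
1728N+1 ⇒ p ∤ 3 ⇒ jacobiSym (−3) p ≠ 0) and (−1)^{ω(N)}·∏_{p∣N}(−1)^{v_p(N)+1} =
∏_{p∣N}(−1)^{v_p(N)} = (−1)^{Ω(N)} = λ(N) (ArithmeticFunction.cardDistinctFactors, Nat.primeFactors,
padicValNat, ArithmeticFunction.liouville); so the inner sums of SelmerParityLevel and
LiouvilleRootClassLevel agree up to a global sign inside |·|, term by term on the filter 0 < F(t).
[deps: PencilSelmerParity, SelmerParityLevel, LiouvilleRootClassLevel] [difficulty: provable-now] -/
@[route_item "route-Parity-SelmerPencil", crux]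
def ParityToLiouville : Prop :=
  PencilSelmerParity → SelmerParityLevel → LiouvilleRootClassLevel

/-- item stmt-Parity-9652 · support · rank 9 · open · by planner
sources: BatemanHorn1962, stmt-Parity-0875
[support] PolyMobiusTail (inlined) → TypeIMainTerm → LambdaToCount → BatemanHorn: the bookkeeping of
route PolynomialMobius (its assembly stmt-Parity-0875: ∏Λ(f_i(n)) = (−1)^k Σ_{d_i∣f_i(n)} ∏μ(d_i)
log d_i by ArithmeticFunction.sum_moebius_mul_log_eq, split at ∏d_i ≤ x^{1−η},
IsEquivalent.add_isLittleO, then LambdaToCount and BatemanHornConjecture = ∀ k f,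
IsBatemanHornSystem f → BatemanHornAsymptotic f). Provable now. [difficulty: provable-now] -/
@[route_item "route-Parity-SelmerPencil", crux]
def TailToBatemanHorn : Prop :=
  (∀ (k : ℕ) (f : Fin k → Polynomial ℤ), Literature.NumberTheory.Sieve.IsBatemanHornSystem f → ∃ η : ℝ, 0 < η ∧ η < 1 ∧ (fun x : ℕ => ∑ n ∈ Finset.Icc 1 x, ∑ d ∈ Fintype.piFinset (fun i => (((f i).eval (n : ℤ)).toNat).divisors), if (x : ℝ) ^ (1 - η) < ∏ i, (d i : ℝ) then ∏ i, ((ArithmeticFunction.moebius (d i) : ℝ) * Real.log (d i)) else 0) =o[Filter.atTop] fun x : ℕ => (x : ℝ)) → TypeIMainTerm → LambdaToCount → _root_.BatemanHorn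

-- earlier Assembly (stmt-Parity-9653, replaced 2026-08-15T17:00:45Z -> stmt-Parity-11295): retired by None — TwoParityPencil → SelmerParityLevel → PencilRootNumber → TailGivenParity → TypeIMainTerm → LambdaToCount → _root_.BatemanHorn
/-- item stmt-Parity-11295 · assembly · rank 1 · open · by planner
sources: Helfgott2003RootNumbers, DokchitserDokchitserAnnals2010, BatemanHorn1962
[assembly] TwoParityPencil → SelmerParityLevel → PencilRootNumber → TailGivenParity → TypeIMainTerm
→ LambdaToCount → BatemanHorn. -/
@[route_item "route-Parity-SelmerPencil", crux]
def Assembly : Prop :=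
  PencilSelmerParity → SelmerParityLevel → TailGivenParity → TypeIMainTerm → LambdaToCount → _root_.BatemanHorn

/-! D-0027 §2.1 — DECIDING THEOREM (planner-authored via `route open/edit --closes-file`; by planner-rrepair-Parity-SelmerPencil-caac3982-g2-0 2026-08-15T17:00:45Z):
its hypotheses are this route's items and its conclusion the sub-problem Statement (glue_lint), and it elaborates with this file. -/

/-- D-0027 §2.1 deciding theorem (rev 1, cone repair 2026-08-15): hypotheses = the eleven items of route SelmerPencil,
conclusion = the sub-problem statement `BatemanHorn` (= Literature.NumberTheory.Sieve.BatemanHornConjecture). Pure logic: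
ParityToLiouville turns PencilSelmerParity ∧ SelmerParityLevel into LiouvilleRootClassLevel, TailGivenParity turns that
into the Möbius tail for every system, TailToBatemanHorn closes with the Type-I main term and the Λ-to-count step
(equivalently `hAsm hP hS hT hM hL`). -/
@[closes "route-Parity-SelmerPencil"] theorem closes (hP : PencilSelmerParity) (hS : SelmerParityLevel) (_hA : SelmerParityAtom)
    (_hJ : LiouvilleRootClassLevel) (hT : TailGivenParity) (hM : TypeIMainTerm) (hL : LambdaToCount)
    (_hR : PencilReduction) (g₁ : ParityToLiouville) (g₂ : TailToBatemanHorn) (_hAsm : Assembly) :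
    _root_.BatemanHorn :=
  g₂ (hT (g₁ hP hS)) hM hL

end Summit.Parity.BatemanHorn.Theses.SelmerPencil
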